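import Summits.Ventures.PercRepro.RankLevelSetBiIndepLRUniform
import Summits.Ventures.PercRepro.RankLevelSetBiIndepLRTruncate
import Summits.Ventures.PercRepro.RankLevelSetBiIndepLRParallel

/-! # RankLevelSetBiIndepLRModel — THE WHOLE MODEL FAMILY SATISFIES THE LIKELIHOOD-RATIO MONOTONICITY (LR),
UNCONDITIONALLY (night-1 g26; dossier §38.10)

THEOREM (`biIndepLR_modelMatroid`): `BiIndepLR (modelMatroid hE F q p)` for every finite `E`, `F ⊆ E` and all `q, p`.
PROOF by the structure theory: the model `T_p(U_{q,F} ⊕ U_{D,D})` IS the truncation to rank `p` of the disjoint sum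
of the uniform matroid `U_{q,F}` (the model with empty `F` on the ground set `F`) and the free matroid on `D = E ∖ F`
(`modelMatroid_eq_truncateTo_disjointSum`, by `Matroid.ext_indep`); uniform matroids satisfy (LR)
(`biIndepLR_uniform`) and their profiles are ULC — a window of binomial coefficients, PROVED here
(`biIndepULC_uniform`, no citation) — so the sum satisfies (LR) by `biIndepLR_disjointSum_of_ULC` and the truncation
by `biIndepLR_truncateTo`. Hence, with `biIndepPerElem_of_LR`, the model family satisfies (★★), the monotone form and
the global level-wise theorems with NO Lorentzian input — a second, structural proof of g24's
`modelMatroid_biIndepPerElem`, one rung higher on the ladder. Every declaration has a docstring; imports: the cell's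
own modules and Mathlib only. Axioms: standard. -/

namespace PercRepro

open Set Matroid

variable {α : Type}

/-! ## The uniform profile is ULC (a window of binomials) -/

/-- **The profile of the uniform model**: `D_r = C(#E, r)` for `r ≤ p`, `#E − r ≤ p`, and `0` otherwise. -/
lemma biIndepCount_uniform {E : Set α} (hE : E.Finite) (q p r : ℕ) :
    haveI := modelMatroid_finite hE ∅ q p
    biIndepCount (modelMatroid hE ∅ q p) r = if r ≤ p ∧ E.ncard - r ≤ p then E.ncard.choose r else 0 := by
  haveI := modelMatroid_finite hE ∅ q p
  unfold biIndepCount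
  split_ifs with hw
  · rw [← ncard_subsets_of_finite hE r]
    congr 1
    ext S
    simp only [Set.mem_setOf_eq, uniform_mem_biIndep_iff]
    exact ⟨fun h => ⟨h.1, h.2.1⟩, fun h => ⟨h.1, h.2, hw.1, hw.2⟩⟩
  · rw [Set.ncard_eq_zero (biIndep_finite _ r)]
    ext S
    simp only [Set.mem_empty_iff_false, iff_false, uniform_mem_biIndep_iff]
    rintro ⟨-, -, h1, h2⟩
    exact hw ⟨h1, h2⟩

/-- **The uniform profile is ULC**: its normalised profile is the indicator of an interval. -/
theorem biIndepULC_uniform {E : Set α} (hE : E.Finite) (q p : ℕ) :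
    haveI := modelMatroid_finite hE ∅ q p
    BiIndepULC (modelMatroid hE ∅ q p) := by
  haveI := modelMatroid_finite hE ∅ q p
  have hground : (modelMatroid hE ∅ q p).E.ncard = E.ncard := by rw [modelMatroid_E]
  constructor
  · intro r hr hrn
    unfold biIndepNorm
    rw [hground, biIndepCount_uniform, biIndepCount_uniform, biIndepCount_uniform]
    rw [hground] at hrn
    have hC : ∀ s, s ≤ E.ncard → (0 : ℚ) < (E.ncard.choose s : ℚ) := fun s hs => by
      exact_mod_cast Nat.choose_pos hs
    by_cases hw : r - 1 ≤ p ∧ E.ncard - (r - 1) ≤ p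
    · by_cases hw' : r + 1 ≤ p ∧ E.ncard - (r + 1) ≤ p
      · rw [if_pos hw, if_pos hw', if_pos (by omega)]
        rw [div_self (hC _ (by omega)).ne', div_self (hC _ (by omega)).ne', div_self (hC _ (by omega)).ne']
        norm_num
      · rw [if_neg hw']
        simp only [Nat.cast_zero, zero_div, mul_zero]
        positivity
    · rw [if_neg hw]
      simp only [Nat.cast_zero, zero_div, zero_mul]
      positivity
  · intro a b c hab hbc ha hc
    rw [biIndepCount_uniform] at ha hc ⊢
    split_ifs at ha with hwa
    · split_ifs at hc with hwc
      · rw [if_pos ⟨by omega, by omega⟩]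
        have hcn : c ≤ E.ncard := by
          by_contra hlt
          rw [Nat.choose_eq_zero_of_lt (by omega)] at hc
          exact lt_irrefl 0 hc
        exact Nat.choose_pos (by omega)
      · exact absurd hc (lt_irrefl 0)
    · exact absurd ha (lt_irrefl 0)

/-! ## The model is a truncated direct sum of uniform matroids -/

/-- **The model matroid is the truncation of the direct sum** `U_{q,F} ⊕ U_{D,D}` (`D = E ∖ F`) to rank `p`. -/
theorem modelMatroid_eq_truncateTo_disjointSum {E : Set α} (hE : E.Finite) {F : Set α} (hF : F ⊆ E) (q p : ℕ) :
    haveI := modelMatroid_finite (hE.subset hF) ∅ q q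
    haveI := modelMatroid_finite ((hE.subset (Set.sdiff_subset : E \ F ⊆ E))) ∅ (E \ F).ncard (E \ F).ncard
    haveI : ((modelMatroid (hE.subset hF) ∅ q q).disjointSum
        (modelMatroid ((hE.subset (Set.sdiff_subset : E \ F ⊆ E))) ∅ (E \ F).ncard (E \ F).ncard)
        Set.disjoint_sdiff_right).Finite :=
      ⟨by rw [Matroid.disjointSum_ground_eq, modelMatroid_E, modelMatroid_E]
          exact (hE.subset hF).union ((hE.subset (Set.sdiff_subset : E \ F ⊆ E)))⟩
    modelMatroid hE F q p = truncateTo ((modelMatroid (hE.subset hF) ∅ q q).disjointSum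
        (modelMatroid ((hE.subset (Set.sdiff_subset : E \ F ⊆ E))) ∅ (E \ F).ncard (E \ F).ncard)
        Set.disjoint_sdiff_right) p := by
  haveI := modelMatroid_finite (hE.subset hF) ∅ q q
  haveI := modelMatroid_finite ((hE.subset (Set.sdiff_subset : E \ F ⊆ E))) ∅ (E \ F).ncard (E \ F).ncard
  have hdisj : Disjoint (modelMatroid (hE.subset hF) ∅ q q).E
      (modelMatroid ((hE.subset (Set.sdiff_subset : E \ F ⊆ E))) ∅ (E \ F).ncard (E \ F).ncard).E :=
    Set.disjoint_sdiff_right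
  haveI : ((modelMatroid (hE.subset hF) ∅ q q).disjointSum
      (modelMatroid ((hE.subset (Set.sdiff_subset : E \ F ⊆ E))) ∅ (E \ F).ncard (E \ F).ncard) hdisj).Finite :=
    ⟨by rw [Matroid.disjointSum_ground_eq, modelMatroid_E, modelMatroid_E]
        exact (hE.subset hF).union ((hE.subset (Set.sdiff_subset : E \ F ⊆ E)))⟩
  refine Matroid.ext_indep ?_ ?_
  · rw [truncateTo_E, Matroid.disjointSum_ground_eq, modelMatroid_E, modelMatroid_E, modelMatroid_E,
      Set.union_sdiff_cancel hF]
  · intro X hX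
    rw [modelMatroid_E] at hX
    rw [modelMatroid_indep_iff, truncateTo_indep_iff, Matroid.disjointSum_indep_iff, modelMatroid_indep_iff,
      modelMatroid_indep_iff, modelMatroid_E, modelMatroid_E]
    constructor
    · rintro ⟨-, hXF, hXp⟩
      refine ⟨⟨⟨Set.inter_subset_right, by simp, hXF⟩, ⟨Set.inter_subset_right, by simp, ?_⟩,
        by rw [Set.union_sdiff_cancel hF]; exact hX⟩, hXp⟩
      exact Set.ncard_le_ncard Set.inter_subset_right ((hE.subset (Set.sdiff_subset : E \ F ⊆ E)))
    · rintro ⟨⟨⟨-, -, hXF⟩, -, -⟩, hXp⟩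
      exact ⟨hX, hXF, hXp⟩

/-- Transport of (LR) along an equality of matroids. -/
lemma biIndepLR_of_eq {M M' : Matroid α} [M.Finite] [M'.Finite] (h : M = M') (hM : BiIndepLR M) :
    BiIndepLR M' := by
  subst h
  exact hM

/-- **THE MODEL FAMILY SATISFIES (LR), UNCONDITIONALLY**: `BiIndepLR (modelMatroid hE F q p)`. -/
theorem biIndepLR_modelMatroid {E : Set α} (hE : E.Finite) {F : Set α} (hF : F ⊆ E) (q p : ℕ) :
    haveI := modelMatroid_finite hE F q p
    BiIndepLR (modelMatroid hE F q p) := by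
  haveI := modelMatroid_finite hE F q p
  haveI := modelMatroid_finite (hE.subset hF) ∅ q q
  haveI := modelMatroid_finite ((hE.subset (Set.sdiff_subset : E \ F ⊆ E))) ∅ (E \ F).ncard (E \ F).ncard
  have hdisj : Disjoint (modelMatroid (hE.subset hF) ∅ q q).E
      (modelMatroid ((hE.subset (Set.sdiff_subset : E \ F ⊆ E))) ∅ (E \ F).ncard (E \ F).ncard).E :=
    Set.disjoint_sdiff_right
  haveI hfin : ((modelMatroid (hE.subset hF) ∅ q q).disjointSum
      (modelMatroid ((hE.subset (Set.sdiff_subset : E \ F ⊆ E))) ∅ (E \ F).ncard (E \ F).ncard) hdisj).Finite :=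
    ⟨by rw [Matroid.disjointSum_ground_eq, modelMatroid_E, modelMatroid_E]
        exact (hE.subset hF).union ((hE.subset (Set.sdiff_subset : E \ F ⊆ E)))⟩
  haveI := truncateTo_finite ((modelMatroid (hE.subset hF) ∅ q q).disjointSum
      (modelMatroid ((hE.subset (Set.sdiff_subset : E \ F ⊆ E))) ∅ (E \ F).ncard (E \ F).ncard) hdisj) p
  refine biIndepLR_of_eq (modelMatroid_eq_truncateTo_disjointSum hE hF q p).symm ?_
  apply biIndepLR_truncateTo
  exact biIndepLR_disjointSum_of_ULC (h := hdisj) (biIndepLR_uniform (hE.subset hF) q q)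
    (biIndepLR_uniform ((hE.subset (Set.sdiff_subset : E \ F ⊆ E))) _ _) (biIndepULC_uniform (hE.subset hF) q q)
    (biIndepULC_uniform ((hE.subset (Set.sdiff_subset : E \ F ⊆ E))) _ _)

/-- **The model family satisfies (★★), the monotone form — by the structure theory of (LR)** (a second proof of
`modelMatroid_biIndepPerElem`). -/
theorem modelMatroid_biIndepPerElem_of_LR {E : Set α} (hE : E.Finite) {F : Set α} (hF : F ⊆ E) (q p : ℕ) :
    haveI := modelMatroid_finite hE F q p
    BiIndepPerElem (modelMatroid hE F q p) := by
  haveI := modelMatroid_finite hE F q p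
  exact biIndepPerElem_of_LR _ (biIndepLR_modelMatroid hE hF q p)

end PercRepro
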